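import Summits.FinalStateConjecture.FinalStateConjecture.Theorems.ClusterCompletenessOmegaLimitMultiKerrDefs
import HarnessLib

/-!
# Route ClusterCompleteness · crux `OmegaLimitMultiKerr` — the T2 vocabulary (posited objects, D-0016 `<Route>Defs` convention)

At 2026-08-16T21:18Z the summit Statement `FinalStateConjecture` was RE-TYPED (semantic-vacuity
audit T2): genericity is now `InitialDataSet.IsTameChristodoulouGeneric` (witness families tame on
ONE fixed asymptotically flat end and immersed at the base point — the topology-free
`IsChristodoulouGeneric` admitted "burial" families receding to infinity with divergent mass) and
the settle clause gained `Summit.FinalStateConjecture.RaysStayInClosure` (the settled region is not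
the witness's to choose) and `Summit.FinalStateConjecture.IsFutureOriented` (chart time is the
`g`-future). The crux `ClusterCompleteness.OmegaLimitMultiKerr` (stmt-FinalStateConjecture-14664,
rev 16, filed 04:22Z the same day) and its vocabulary `Settles / Recurs k / OmegaAt k`
(`ClusterCompletenessOmegaLimitMultiKerrDefs.lean`) predate the re-type. This file (line lead gen 7
of the crux, 2026-08-16) adds — next to, not instead of, the filed vocabulary over which 67 landed
structure files are stated — the matrices the re-typed Statement forces:

* `SettlesT2 𝒟` — VERBATIM the `∀`-MGHD conjunct of the re-typed `FinalStateConjecture`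
  (`finalStateConjecture_iff_tame` is `Iff.rfl`); `settles_of_settlesT2`;
* `OmegaAtT2 k` — the crux at order `k` over TAME genericity with `SettlesT2` in the negated settle
  clause and the recur interface `Recurs k` unchanged: the restatement of `OmegaAt k`/the crux that
  the re-typed Statement forces (the route's deciding theorem consumes the crux only through
  monotonicity of the SAME genericity as the Statement's);
* the read-backs a line needs on day one: `omegaAtT2_anti` (antitone in `k`),
  `omegaAt_of_omegaAtT2` (the T2 crux implies the filed one: tame ⇒ topology-free genericity,
  `¬ Settles → ¬ SettlesT2`), `omegaAtT2_of_finalStateConjecture` (NECESSITY is preserved: the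
  re-typed summit implies the T2 crux at every order — the settle branch short-circuits the
  dichotomy and tame genericity is monotone in the property), hence the filed crux as well.

Everything is a definition over EXISTING declarations or a few lines of logic; tame genericity's
monotonicity is a private local copy of `InitialDataSet.IsTameChristodoulouGeneric.mono`
(`Literature/Geometry/Lorentzian/TameGenericityDiagonal.lean`) so that this vocabulary module keeps
the import cone of `…OmegaLimitMultiKerrDefs` (Statement only). References: Dafermos–Luk,
arXiv:1710.01722, §1.2.1 and Conjecture 1; Christodoulou, CQG 16 (1999) A23, p. A24.
-/

-- every `Summit.FinalStateConjecture.FinalStateConjecture.…` name repeats the summit = sub-problem segment (D-0017 layout)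
set_option linter.dupNamespace false

noncomputable section

open scoped Manifold ContDiff Topology ENNReal
open Set Filter TopologicalSpace

namespace Summit.FinalStateConjecture.FinalStateConjecture.Theorems.ClusterCompleteness

open Literature.Geometry.Lorentzian

section PerDevelopment

variable {X : Type} [TopologicalSpace X] [ChartedSpace E3 X] [IsManifold (𝓡 3) ∞ X]
  [ConnectedSpace X] {D : InitialDataSet (𝓡 3) X}

/-- **Settles down, T2 form** (one maximal development `𝒟`): complete future null infinity in
Christodoulou's sojourn sense AND a `C²` final-state decomposition of the self-determined exterior
`O = J⁺(Σ) ∩ I⁻(charted)` into finitely many SUB-EXTREMAL boosted Kerr near zones plus a flat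
radiation zone, every future-complete normalised null ray from the data staying in `closure O`
(`RaysStayInClosure`), the charts EXHAUSTING `O` (`HasExhaustiveCharts`, honest radii) and chart
times FUTURE-ORIENTED (`IsFutureOriented`) — verbatim the `∀`-MGHD conjunct of the re-typed
`FinalStateConjecture` (Dafermos–Luk arXiv:1710.01722, Conjecture 1 and §1.2.1; semantic-vacuity
audit 2026-08-16, T2). [cite: DafermosLuk2017, §1.2.1] -/
def SettlesT2 (𝒟 : VacuumCauchyDevelopment D) : Prop :=
  Summit.FinalStateConjecture.HasCompleteNullInfinity 𝒟.toCauchyDevelopment ∧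
    ∃ (O : Set 𝒟.carrier) (d : FinalStateDecomposition 𝒟.toSpacetime O 2),
      (∀ i, Kerr.IsSubextremal (d.mass i) (d.spin i)) ∧
        O = Summit.FinalStateConjecture.exteriorOf 𝒟.toCauchyDevelopment d.charted ∧
          Summit.FinalStateConjecture.RaysStayInClosure 𝒟.toCauchyDevelopment O ∧
            Summit.FinalStateConjecture.HasExhaustiveCharts d ∧
              Summit.FinalStateConjecture.IsFutureOriented d

/-- The T2 settle clause implies the filed one (forget `RaysStayInClosure` and `IsFutureOriented`).
[folklore] -/
theorem settles_of_settlesT2 {𝒟 : VacuumCauchyDevelopment D} (h : SettlesT2 𝒟) : Settles 𝒟 := by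
  obtain ⟨hI, O, d, hsub, hO, -, hex, -⟩ := h
  exact ⟨hI, O, d, hsub, hO, hex⟩

end PerDevelopment

/-- **The crux at ONE order `k`, T2 form** (the restatement the re-typed Statement forces): for
every connected Hausdorff second-countable smooth `3`-manifold, TAME-Christodoulou-generically in
the admissible class (`InitialDataSet.IsTameChristodoulouGeneric … 1`), an MGHD exists and every
MGHD that does not settle down IN THE T2 SENSE (`SettlesT2`) recurs at order `k` (`Recurs k`,
unchanged: anchored, separating, exhaustive final-state-shaped late charts in which `Cᵏ`
`ε`-closeness to one sub-extremal multi-Kerr configuration recurs for every `ε` and every near-zone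
radius). Implied by the summit (`omegaAtT2_of_finalStateConjecture`), implies the filed `OmegaAt k`
(`omegaAt_of_omegaAtT2`), antitone in `k` (`omegaAtT2_anti`). [cite: DafermosLuk2017, §1.2.1] -/
def OmegaAtT2 (k : ℕ) : Prop :=
  ∀ (X : Type) [TopologicalSpace X] [ChartedSpace E3 X] [IsManifold (𝓡 3) ∞ X] [T2Space X]
    [SecondCountableTopology X] [ConnectedSpace X],
    InitialDataSet.IsTameChristodoulouGeneric (admissibleVacuumData X)
      (fun D ↦ (∃ 𝒟 : VacuumCauchyDevelopment D, 𝒟.IsMaximal) ∧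
        ∀ 𝒟 : VacuumCauchyDevelopment D, 𝒟.IsMaximal → ¬ SettlesT2 𝒟 → Recurs k 𝒟) 1

/-- **The re-typed summit is `SettlesT2`-genericity with anti-vacuity**: `FinalStateConjecture` is
LITERALLY the statement that, for every `3`-manifold, tame-Christodoulou-generically in the
admissible class an MGHD exists and every MGHD settles down in the T2 sense (`Iff.rfl`: `SettlesT2`
is the verbatim matrix). [folklore] -/
theorem finalStateConjecture_iff_tame :
    FinalStateConjecture ↔
      ∀ (X : Type) [TopologicalSpace X] [ChartedSpace E3 X] [IsManifold (𝓡 3) ∞ X] [T2Space X]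
        [SecondCountableTopology X] [ConnectedSpace X],
        InitialDataSet.IsTameChristodoulouGeneric (admissibleVacuumData X)
          (fun D ↦ (∃ 𝒟 : VacuumCauchyDevelopment D, 𝒟.IsMaximal) ∧
            ∀ 𝒟 : VacuumCauchyDevelopment D, 𝒟.IsMaximal → SettlesT2 𝒟) 1 :=
  Iff.rfl

section Genericity

variable {X : Type} [TopologicalSpace X] [ChartedSpace E3 X] [IsManifold (𝓡 3) ∞ X]

/-- Tame Christodoulou genericity is monotone under pointwise implication on the admissible class
(the same tame immersed family through an exceptional datum works; private local copy of
`InitialDataSet.IsTameChristodoulouGeneric.mono` of `TameGenericityDiagonal.lean`, keeping this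
vocabulary module's import cone at the Statement). [folklore] -/
private theorem isTameChristodoulouGeneric_mono {𝓓 : Set (InitialDataSet (𝓡 3) X)}
    {P Q : InitialDataSet (𝓡 3) X → Prop} {m : ℕ}
    (h : InitialDataSet.IsTameChristodoulouGeneric 𝓓 P m) (hPQ : ∀ d ∈ 𝓓, P d → Q d) :
    InitialDataSet.IsTameChristodoulouGeneric 𝓓 Q m := by
  intro d hd
  obtain ⟨e, F, hF, himm, h0, hinj, hadm, hexc⟩ := h d ⟨hd.1, fun hP ↦ hd.2 (hPQ d hd.1 hP)⟩
  exact ⟨e, F, hF, himm, h0, hinj, hadm,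
    fun c hc hmem ↦ hexc c hc ⟨hmem.1, fun hP ↦ hmem.2 (hPQ _ hmem.1 hP)⟩⟩

end Genericity

/-- The T2 crux at order `k'` implies it at every order `k ≤ k'` (tame genericity is monotone in
the property; `recurs_anti`): the `∀ k` of the restated crux is carried by large `k`. [folklore] -/
theorem omegaAtT2_anti {k k' : ℕ} (hk : k ≤ k') (h : OmegaAtT2 k') : OmegaAtT2 k :=
  fun X _ _ _ _ _ _ ↦ isTameChristodoulouGeneric_mono (h X) fun _ _ hP ↦
    ⟨hP.1, fun 𝒟 h𝒟 hS ↦ recurs_anti hk (hP.2 𝒟 h𝒟 hS)⟩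

/-- **The T2 crux implies the crux as filed** at the same order: tame genericity implies the
topology-free notion (`IsTameChristodoulouGeneric.isChristodoulouGeneric`) and
`¬ Settles → ¬ SettlesT2` (`settles_of_settlesT2`), so the recur branch fires. [folklore] -/
theorem omegaAt_of_omegaAtT2 {k : ℕ} (h : OmegaAtT2 k) : OmegaAt k :=
  fun X _ _ _ _ _ _ ↦ (h X).isChristodoulouGeneric.mono fun _ _ hP ↦
    ⟨hP.1, fun 𝒟 h𝒟 hS ↦ hP.2 𝒟 h𝒟 fun hS₂ ↦ hS (settles_of_settlesT2 hS₂)⟩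

/-- **The re-typed summit implies the T2 crux at every order** (the settle branch short-circuits
the dichotomy; tame genericity is monotone in the property): the restated crux is NECESSARY for
the summit exactly as the filed one was, hence never too strong. [folklore] -/
theorem omegaAtT2_of_finalStateConjecture : FinalStateConjecture → ∀ k : ℕ, OmegaAtT2 k :=
  fun h _ X _ _ _ _ _ _ ↦ isTameChristodoulouGeneric_mono (h X) fun _ _ hP ↦
    ⟨hP.1, fun 𝒟 h𝒟 hS ↦ absurd (hP.2 𝒟 h𝒟) hS⟩

end Summit.FinalStateConjecture.FinalStateConjecture.Theorems.ClusterCompleteness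

end
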